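import Summits.CriticalPhenomena.PercolationContinuityZ3.Theorems.PercFiniteBoxLROCerf2015BoxLRO16Covering
import Summits.CriticalPhenomena.PercolationContinuityZ3.Theorems.PercFiniteBoxLROCerf2015BoxLRO16Tools
import HarnessLib

/-!
# `PercFiniteBoxLRO.Cerf2015BoxLRO16` (stmt-CriticalPhenomena-0860), tools V: Cerf's §8 inequality on
# `ℤ³` in polynomial form and one §9 iteration along dyadic scales (bond version)

Helper file (`--supports stmt-CriticalPhenomena-0860`), sequel of `…Covering.lean` and `…Tools.lean`:
the `d = 3` polynomial form of the §8 inequality,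
`n³ P_p(edgeTwoArms i (3n)) ≤ t n^{3/2} j (189 + A k^27 τ(n−k−2)) + (144/p)(2n+1)^9 e^{−2p²(1−p)²t²}`
for `n = (2k+1)j + k` (`cube_mul_real_edgeTwoArms_le`), and Cerf's §9 step along the scales
`n_s = (2·2^s+1) 2^{55 s} + 2^s` with the AKN input `AKN.exists_real_edgeTwoArms_le`:
`P_p(edgeTwoArms i (3 n_s)) √n_s (√2)^s ≤ C` (`real_edgeTwoArms_dyadic_le`) — a two-arms exponent
STRICTLY above `1/2`, which the box `Λ(n^16)` of Theorem 1.3 in `d = 3` requires.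
This file introduces no definition.

## References

* R. Cerf, *A lower bound on the two-arms exponent for critical percolation on the lattice*, Ann.
  Probab. 43 (2015) 2458–2480, arXiv:1306.3105 [Cerf2015].
-/

noncomputable section

namespace Summit.CriticalPhenomena.PercolationContinuityZ3.Theorems

namespace Cerf2015BoxLRO16

open Literature.Probability.Percolation Literature.Probability.Percolation.AKN
  Literature.Probability.Percolation.GM Literature.Probability.LatticeModels MeasureTheory Finset Real
open scoped Classical

variable {d : ℕ}

/-- **Cerf 2015, §8, last display, bond version on `ℤ³` with explicit polynomial bookkeeping**: for
`0 < p < 1` with `θ(p) > 0` there is `A ≥ 0` such that for all `k, j ≥ 1`, `n = (2k+1)j + k ≥ k + 3`,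
`t ≥ 0` and every direction `i`,
`n³ P_p(edgeTwoArms i (3n)) ≤ t n^{3/2} j (189 + A k^{27} τ(n−k−2)) + (144/p) (2n+1)^9 e^{−2p²(1−p)²t²}`,
`τ(m) = Σ_i P_p(edgeTwoArms i m)` (Cerf: `P(two-arms(0,3n)) ≤ (c ln n/√n)(k^{−(d−1)} + k^{2d²+2d−2}
P(two-arms(0,n−k)))^{1/2}`; here the covering count enters linearly, `E√|𝒞| ≤ (E|𝒞|/M + M)/2` with
`M = 2j+1`). [cite: Cerf2015, §8–§9] -/
theorem cube_mul_real_edgeTwoArms_le (p : unitInterval) (hp0 : 0 < (p : ℝ)) (hp1 : (p : ℝ) < 1)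
    (hθ : 0 < theta (zdGraph 3) 0 p) :
    ∃ A : ℝ, 0 ≤ A ∧ ∀ (i : Fin 3) (k j n : ℕ), 1 ≤ k → 1 ≤ j → n = (2 * k + 1) * j + k → k + 3 ≤ n →
      ∀ t : ℝ, 0 ≤ t →
        (n : ℝ) ^ 3 * (bondPercolation (zdGraph 3) p).real (edgeTwoArms i (3 * n)) ≤
          t * Real.sqrt ((n : ℝ) ^ 3) * j *
              (189 + A * (k : ℝ) ^ 27 * ∑ i' : Fin 3, (bondPercolation (zdGraph 3) p).real (edgeTwoArms i' (n - k - 2))) +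
            144 / p * (2 * (n : ℝ) + 1) ^ 9 * Real.exp (-2 * (p : ℝ) ^ 2 * (1 - p) ^ 2 * t ^ 2) := by
  obtain ⟨K₂, hK₂⟩ : ∃ K₂ : ℝ, K₂ = (3 : ℝ) ^ 18 * 7 ^ 7 * 6 ^ 6 / ((p : ℝ) ^ 9 * theta (zdGraph 3) 0 p ^ 6) := ⟨_, rfl⟩
  have hK₂0 : 0 ≤ K₂ := by rw [hK₂]; positivity
  refine ⟨4374 * K₂, by positivity, ?_⟩
  intro i k j n hk hj hn hkn t ht
  have hn1 : 1 ≤ n := by omega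
  have hk0 : (0 : ℝ) < k := by exact_mod_cast hk
  have hj0 : (0 : ℝ) < j := by exact_mod_cast hj
  have hn0 : (0 : ℝ) < n := by exact_mod_cast hn1
  have hk1 : (1 : ℝ) ≤ k := by exact_mod_cast hk
  have hj1 : (1 : ℝ) ≤ j := by exact_mod_cast hj
  -- the sum of the statistics `T` and the box two-arms sum `S`
  obtain ⟨T, hT⟩ : ∃ T : ℝ, T = ∑ i' : Fin 3, (bondPercolation (zdGraph 3) p).real (edgeTwoArms i' (n - k - 2)) := ⟨_, rfl⟩
  have hT0 : 0 ≤ T := by rw [hT]; exact Finset.sum_nonneg fun _ _ => measureReal_nonneg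
  obtain ⟨S, hS⟩ : ∃ S : ℝ, S = ∑ z ∈ box 3 k, ∑ z' ∈ box 3 k, (bondPercolation (zdGraph 3) p).real (twoArmsBox k n z z') :=
    ⟨_, rfl⟩
  have hS0 : 0 ≤ S := by rw [hS]; exact Finset.sum_nonneg fun _ _ => Finset.sum_nonneg fun _ _ => measureReal_nonneg
  rw [← hT]
  -- Step A's inequality with `M = 2j + 1`, `ℓ = n`
  have hM : (0 : ℝ) < 2 * (j : ℝ) + 1 := by linarith
  have hcov := card_mul_real_edgeTwoArms_le_cover (d := 3) p hp0 hp1 i hn hn1 hn1 ht hM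
  rw [show 2 * n + n = 3 * n by ring, ← hS] at hcov
  -- (i) the left-hand side
  have hL : (n : ℝ) ^ 3 * (bondPercolation (zdGraph 3) p).real (edgeTwoArms i (3 * n)) ≤
      ((box 3 (n - 1)).card : ℝ) * (bondPercolation (zdGraph 3) p).real (edgeTwoArms i (3 * n)) := by
    refine mul_le_mul_of_nonneg_right ?_ measureReal_nonneg
    rw [card_box]
    have h2 : (n : ℝ) ≤ ((2 * (n - 1) + 1 : ℕ) : ℝ) := by
      have : n ≤ 2 * (n - 1) + 1 := by omega
      exact_mod_cast this
    calc (n : ℝ) ^ 3 ≤ ((2 * (n - 1) + 1 : ℕ) : ℝ) ^ 3 := pow_le_pow_left₀ hn0.le h2 3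
      _ = (((2 * (n - 1) + 1) ^ 3 : ℕ) : ℝ) := by push_cast; ring
  -- (ii) `√(2|E(Λ_n)|) ≤ 18 n^{3/2}`
  have hE := card_edgesIn_box_three_le n
  have hX3 : (2 * (n : ℝ) + 1) ≤ 3 * n := by linarith [show (1 : ℝ) ≤ n by exact_mod_cast hn1]
  have hX0 : (0 : ℝ) ≤ 2 * (n : ℝ) + 1 := by linarith
  have hn3 : (0 : ℝ) ≤ (n : ℝ) ^ 3 := by positivity
  have hsqE : Real.sqrt (2 * (edgesIn (zdGraph 3) (box 3 n)).card) ≤ 18 * Real.sqrt ((n : ℝ) ^ 3) := by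
    have h1 : (2 : ℝ) * (edgesIn (zdGraph 3) (box 3 n)).card ≤ 18 ^ 2 * (n : ℝ) ^ 3 := by
      have : (2 * (n : ℝ) + 1) ^ 3 ≤ (3 * (n : ℝ)) ^ 3 := pow_le_pow_left₀ hX0 hX3 3
      nlinarith
    calc Real.sqrt (2 * (edgesIn (zdGraph 3) (box 3 n)).card) ≤ Real.sqrt (18 ^ 2 * (n : ℝ) ^ 3) := Real.sqrt_le_sqrt h1
      _ = 18 * Real.sqrt ((n : ℝ) ^ 3) := by rw [Real.sqrt_mul (by norm_num), Real.sqrt_sq (by norm_num)]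
  -- (iii) the box two-arms sum
  have hSle : S ≤ K₂ * (k : ℝ) ^ 24 * T := by
    have h := sum_real_twoArmsBox_three_le p hp0 hθ hk hkn
    rwa [← hS, ← hT, ← hK₂] at h
  -- (iv) the bracket
  have hBj := card_innerBoundary_box_three_le j
  have hc3S : (2 * (k : ℝ) + 1) ^ 3 * S ≤ 27 * K₂ * (k : ℝ) ^ 27 * T := by
    have hc : (2 * (k : ℝ) + 1) ^ 3 ≤ 27 * (k : ℝ) ^ 3 := by
      have h23 : (2 * (k : ℝ) + 1) ≤ 3 * (k : ℝ) := by linarith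
      calc (2 * (k : ℝ) + 1) ^ 3 ≤ (3 * (k : ℝ)) ^ 3 := pow_le_pow_left₀ (by linarith) h23 3
        _ = 27 * (k : ℝ) ^ 3 := by ring
    have hKT : 0 ≤ K₂ * (k : ℝ) ^ 24 * T := mul_nonneg (mul_nonneg hK₂0 (by positivity)) hT0
    calc (2 * (k : ℝ) + 1) ^ 3 * S ≤ (27 * (k : ℝ) ^ 3) * (K₂ * (k : ℝ) ^ 24 * T) :=
          mul_le_mul hc hSle hS0 (by positivity)
      _ = 27 * K₂ * (k : ℝ) ^ 27 * T := by ring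
  have hKT27 : 0 ≤ K₂ * (k : ℝ) ^ 27 * T := mul_nonneg (mul_nonneg hK₂0 (by positivity)) hT0
  have hW0 : 0 ≤ 7 / 2 + 81 * K₂ * (k : ℝ) ^ 27 * T := by nlinarith
  have hbr : ((innerBoundary (zdGraph 3) (box 3 j)).card : ℝ) * (1 + (2 * (k : ℝ) + 1) ^ 3 * S) / (2 * (2 * (j : ℝ) + 1)) +
      (2 * (j : ℝ) + 1) / 2 ≤ 3 * j * (7 / 2 + 81 * K₂ * (k : ℝ) ^ 27 * T) := by
    have h1 : ((innerBoundary (zdGraph 3) (box 3 j)).card : ℝ) * (1 + (2 * (k : ℝ) + 1) ^ 3 * S) / (2 * (2 * (j : ℝ) + 1)) ≤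
        3 * (2 * (j : ℝ) + 1) * (1 + 27 * K₂ * (k : ℝ) ^ 27 * T) := by
      rw [div_le_iff₀ (by linarith)]
      have hS1 : 0 ≤ 1 + (2 * (k : ℝ) + 1) ^ 3 * S := by positivity
      calc ((innerBoundary (zdGraph 3) (box 3 j)).card : ℝ) * (1 + (2 * (k : ℝ) + 1) ^ 3 * S)
          ≤ (6 * (2 * (j : ℝ) + 1) ^ 2) * (1 + 27 * K₂ * (k : ℝ) ^ 27 * T) :=
            mul_le_mul hBj (by linarith) hS1 (by positivity)
        _ = 3 * (2 * (j : ℝ) + 1) * (1 + 27 * K₂ * (k : ℝ) ^ 27 * T) * (2 * (2 * (j : ℝ) + 1)) := by ring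
    have h2 : (2 * (j : ℝ) + 1) ≤ 3 * j := by linarith
    calc _ ≤ 3 * (2 * (j : ℝ) + 1) * (1 + 27 * K₂ * (k : ℝ) ^ 27 * T) + (2 * (j : ℝ) + 1) / 2 := add_le_add h1 le_rfl
      _ = (2 * (j : ℝ) + 1) * (7 / 2 + 81 * K₂ * (k : ℝ) ^ 27 * T) := by ring
      _ ≤ (3 * j) * (7 / 2 + 81 * K₂ * (k : ℝ) ^ 27 * T) := mul_le_mul_of_nonneg_right h2 hW0
      _ = _ := by ring
  -- (v) the junk term
  have hJ : 2 * ((edgesIn (zdGraph 3) (box 3 n)).card : ℝ) / p *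
      (2 * ((box 3 n).card : ℝ) * (edgesIn (zdGraph 3) (box 3 n)).card * Real.exp (-2 * (p : ℝ) ^ 2 * (1 - p) ^ 2 * t ^ 2)) ≤
      144 / p * (2 * (n : ℝ) + 1) ^ 9 * Real.exp (-2 * (p : ℝ) ^ 2 * (1 - p) ^ 2 * t ^ 2) := by
    rw [card_box]
    push_cast
    have he0 : 0 ≤ Real.exp (-2 * (p : ℝ) ^ 2 * (1 - p) ^ 2 * t ^ 2) := (Real.exp_pos _).le
    have hE0 : 0 ≤ ((edgesIn (zdGraph 3) (box 3 n)).card : ℝ) := Nat.cast_nonneg _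
    have h1 : 2 * ((edgesIn (zdGraph 3) (box 3 n)).card : ℝ) / p *
        (2 * (2 * (n : ℝ) + 1) ^ 3 * (edgesIn (zdGraph 3) (box 3 n)).card) ≤ 144 / p * (2 * (n : ℝ) + 1) ^ 9 := by
      rw [div_mul_eq_mul_div, div_mul_eq_mul_div, div_le_div_iff_of_pos_right hp0]
      have hX30 : 0 ≤ (2 * (n : ℝ) + 1) ^ 3 := pow_nonneg hX0 3
      calc 2 * ((edgesIn (zdGraph 3) (box 3 n)).card : ℝ) * (2 * (2 * (n : ℝ) + 1) ^ 3 * (edgesIn (zdGraph 3) (box 3 n)).card)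
          = 4 * (2 * (n : ℝ) + 1) ^ 3 * (((edgesIn (zdGraph 3) (box 3 n)).card : ℝ) * (edgesIn (zdGraph 3) (box 3 n)).card) := by ring
        _ ≤ 4 * (2 * (n : ℝ) + 1) ^ 3 * ((6 * (2 * (n : ℝ) + 1) ^ 3) * (6 * (2 * (n : ℝ) + 1) ^ 3)) :=
            mul_le_mul_of_nonneg_left (mul_le_mul hE hE hE0 (by positivity)) (by positivity)
        _ = 144 * (2 * (n : ℝ) + 1) ^ 9 := by ring
    calc _ = (2 * ((edgesIn (zdGraph 3) (box 3 n)).card : ℝ) / p *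
          (2 * (2 * (n : ℝ) + 1) ^ 3 * (edgesIn (zdGraph 3) (box 3 n)).card)) * Real.exp (-2 * (p : ℝ) ^ 2 * (1 - p) ^ 2 * t ^ 2) := by ring
      _ ≤ (144 / p * (2 * (n : ℝ) + 1) ^ 9) * Real.exp (-2 * (p : ℝ) ^ 2 * (1 - p) ^ 2 * t ^ 2) :=
          mul_le_mul_of_nonneg_right h1 he0
      _ = _ := by ring
  -- (vi) assemble
  have h1p1 : 1 - (p : ℝ) ≤ 1 := by linarith [p.2.1]
  have hsq0 : 0 ≤ Real.sqrt (2 * (edgesIn (zdGraph 3) (box 3 n)).card) := Real.sqrt_nonneg _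
  have hbr0 : 0 ≤ ((innerBoundary (zdGraph 3) (box 3 j)).card : ℝ) * (1 + (2 * (k : ℝ) + 1) ^ 3 * S) / (2 * (2 * (j : ℝ) + 1)) +
      (2 * (j : ℝ) + 1) / 2 :=
    add_nonneg (div_nonneg (mul_nonneg (Nat.cast_nonneg _) (by positivity)) (by linarith)) (by linarith)
  have hrhs0 : 0 ≤ t * (18 * Real.sqrt ((n : ℝ) ^ 3)) :=
    mul_nonneg ht (mul_nonneg (by norm_num) (Real.sqrt_nonneg _))
  have hin : t * Real.sqrt (2 * (edgesIn (zdGraph 3) (box 3 n)).card) *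
      (((innerBoundary (zdGraph 3) (box 3 j)).card : ℝ) * (1 + (2 * (k : ℝ) + 1) ^ 3 * S) / (2 * (2 * (j : ℝ) + 1)) +
        (2 * (j : ℝ) + 1) / 2) ≤
      t * (18 * Real.sqrt ((n : ℝ) ^ 3)) * (3 * j * (7 / 2 + 81 * K₂ * (k : ℝ) ^ 27 * T)) :=
    mul_le_mul (mul_le_mul_of_nonneg_left hsqE ht) hbr hbr0 hrhs0
  have hin0 : 0 ≤ t * Real.sqrt (2 * (edgesIn (zdGraph 3) (box 3 n)).card) *
      (((innerBoundary (zdGraph 3) (box 3 j)).card : ℝ) * (1 + (2 * (k : ℝ) + 1) ^ 3 * S) / (2 * (2 * (j : ℝ) + 1)) +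
        (2 * (j : ℝ) + 1) / 2) := mul_nonneg (mul_nonneg ht hsq0) hbr0
  have hmain : (1 - (p : ℝ)) * (t * Real.sqrt (2 * (edgesIn (zdGraph 3) (box 3 n)).card) *
      (((innerBoundary (zdGraph 3) (box 3 j)).card : ℝ) * (1 + (2 * (k : ℝ) + 1) ^ 3 * S) / (2 * (2 * (j : ℝ) + 1)) +
        (2 * (j : ℝ) + 1) / 2)) ≤
      t * Real.sqrt ((n : ℝ) ^ 3) * j * (189 + 4374 * K₂ * (k : ℝ) ^ 27 * T) := by
    calc _ ≤ 1 * (t * Real.sqrt (2 * (edgesIn (zdGraph 3) (box 3 n)).card) *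
          (((innerBoundary (zdGraph 3) (box 3 j)).card : ℝ) * (1 + (2 * (k : ℝ) + 1) ^ 3 * S) / (2 * (2 * (j : ℝ) + 1)) +
            (2 * (j : ℝ) + 1) / 2)) := mul_le_mul_of_nonneg_right h1p1 hin0
      _ ≤ t * (18 * Real.sqrt ((n : ℝ) ^ 3)) * (3 * j * (7 / 2 + 81 * K₂ * (k : ℝ) ^ 27 * T)) := by rw [one_mul]; exact hin
      _ = _ := by ring
  exact hL.trans (hcov.trans (add_le_add hmain hJ))

/-- **Cerf 2015, §9, one iteration step, bond version on `ℤ³` along the dyadic scales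
`n_s = (2·2^s + 1) 2^{55 s} + 2^s`** (boxes `Λ(2^s)`, `2^{55 s}` of them per row, `ℓ = n_s`,
`t² = 10 ln(2n_s+1)/(2p²(1−p)²)`): for `0 < p < 1` with `θ(p) > 0` there is `C` with
`P_p(edgeTwoArms i (3 n_s)) √n_s (√2)^s ≤ C` for all `s ≥ 1` — an exponent `1/2 + 1/112` in place of
Cerf's `γ₁ = 1/2 + (d−1)/(2(4d²+6d−6)) = 1/2 + 1/48`. [cite: Cerf2015, §9] -/
theorem real_edgeTwoArms_dyadic_le (p : unitInterval) (hp0 : 0 < (p : ℝ)) (hp1 : (p : ℝ) < 1)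
    (hθ : 0 < theta (zdGraph 3) 0 p) :
    ∃ C : ℝ, ∀ (s n : ℕ), 1 ≤ s → n = (2 * 2 ^ s + 1) * 2 ^ (55 * s) + 2 ^ s → ∀ i : Fin 3,
      (bondPercolation (zdGraph 3) p).real (edgeTwoArms i (3 * n)) * Real.sqrt n * Real.sqrt 2 ^ s ≤ C := by
  obtain ⟨A, hA0, hA⟩ := cube_mul_real_edgeTwoArms_le p hp0 hp1 hθ
  -- the AKN input, uniformly on `[δ, 1-δ] ∋ p`
  have h1p : 0 < 1 - (p : ℝ) := by linarith
  obtain ⟨δ, hδ⟩ : ∃ δ : ℝ, δ = min (min (p : ℝ) (1 - p)) (1 / 2) := ⟨_, rfl⟩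
  have hδ0 : 0 < δ := by rw [hδ]; exact lt_min (lt_min hp0 h1p) (by norm_num)
  have hδ2 : δ ≤ 1 / 2 := by rw [hδ]; exact min_le_right _ _
  have hδp : δ ≤ p := by rw [hδ]; exact (min_le_left _ _).trans (min_le_left _ _)
  have hδp' : (p : ℝ) ≤ 1 - δ := by
    have : δ ≤ 1 - p := by rw [hδ]; exact (min_le_left _ _).trans (min_le_right _ _)
    linarith
  obtain ⟨κ, hκ0, hκ⟩ := exists_real_edgeTwoArms_le (d := 3) (by norm_num) hδ0 hδ2
  -- constants
  obtain ⟨c₀, hc₀⟩ : ∃ c₀ : ℝ, c₀ = 2 * (p : ℝ) ^ 2 * (1 - p) ^ 2 := ⟨_, rfl⟩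
  have hc₀0 : 0 < c₀ := by rw [hc₀]; positivity
  obtain ⟨A₃, hA₃⟩ : ∃ A₃ : ℝ, A₃ = 189 + A * (171 * κ) := ⟨_, rfl⟩
  have hA₃0 : 0 ≤ A₃ := by rw [hA₃]; positivity
  refine ⟨12 / Real.sqrt c₀ * A₃ + 144 / p, ?_⟩
  intro s n hs hn i
  -- the integers `K = 2^s`, `J = 2^{55 s}`, `P = J K = 2^{56 s}`
  obtain ⟨K, hK⟩ : ∃ K : ℕ, K = 2 ^ s := ⟨_, rfl⟩
  obtain ⟨J, hJ⟩ : ∃ J : ℕ, J = 2 ^ (55 * s) := ⟨_, rfl⟩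
  obtain ⟨P, hP⟩ : ∃ P : ℕ, P = 2 ^ (56 * s) := ⟨_, rfl⟩
  have hPJK : P = J * K := by rw [hP, hJ, hK, ← pow_add]; congr 1; ring
  have hK2 : 2 ≤ K := by
    rw [hK]
    calc 2 = 2 ^ 1 := rfl
      _ ≤ 2 ^ s := Nat.pow_le_pow_right (by norm_num) hs
  have hJ2 : 2 ≤ J := by
    rw [hJ]
    calc 2 = 2 ^ 1 := rfl
      _ ≤ 2 ^ (55 * s) := Nat.pow_le_pow_right (by norm_num) (by omega)
  have hP2J : 2 * J ≤ P := by rw [hPJK]; nlinarith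
  have hP2K : 2 * K ≤ P := by rw [hPJK]; nlinarith
  have hnP : n = 2 * P + J + K := by rw [hn, hPJK, hK, hJ]; ring
  have hn1 : 1 ≤ n := by omega
  have hKn : K + 3 ≤ n := by omega
  have hPle : P ≤ n - K - 2 := by omega
  have hP1 : 1 ≤ P := by omega
  -- real versions
  have hKr : (K : ℝ) = 2 ^ s := by rw [hK]; push_cast; ring
  have hPr : (P : ℝ) = 2 ^ (56 * s) := by rw [hP]; push_cast; ring
  have hK0 : (0 : ℝ) < K := by rw [hKr]; positivity
  have hP0 : (0 : ℝ) < P := by rw [hPr]; positivity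
  have hn0 : (0 : ℝ) < n := by exact_mod_cast hn1
  have hnr1 : (1 : ℝ) ≤ n := by exact_mod_cast hn1
  have h2JK : 2 * ((J : ℝ) * K) ≤ n := by
    have : 2 * (J * K) ≤ n := by rw [← hPJK]; omega
    exact_mod_cast this
  have hKlen : (K : ℝ) ≤ n := by
    have : K ≤ n := by omega
    exact_mod_cast this
  have hX8P : 2 * (n : ℝ) + 1 ≤ 8 * P := by
    have : 2 * n + 1 ≤ 8 * P := by omega
    exact_mod_cast this
  -- Step B4 at these parameters
  obtain ⟨X, hX⟩ : ∃ X : ℝ, X = 2 * (n : ℝ) + 1 := ⟨_, rfl⟩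
  have hX1 : 1 ≤ X := by rw [hX]; linarith
  have hX0 : 0 < X := by linarith
  have hlogX0 : 0 ≤ Real.log X := Real.log_nonneg hX1
  obtain ⟨t, ht⟩ : ∃ t : ℝ, t = Real.sqrt (10 * Real.log X / c₀) := ⟨_, rfl⟩
  have ht0 : 0 ≤ t := by rw [ht]; exact Real.sqrt_nonneg _
  have htsq : t ^ 2 = 10 * Real.log X / c₀ := by rw [ht, Real.sq_sqrt (by positivity)]
  have hB4 := hA i K J n (by omega) (by omega) (by rw [hnP, hPJK]; ring) hKn t ht0
  -- the exponential factor is `X^{-10}`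
  have hexp : Real.exp (-2 * (p : ℝ) ^ 2 * (1 - p) ^ 2 * t ^ 2) = (X ^ 10)⁻¹ := by
    have h1 : -2 * (p : ℝ) ^ 2 * (1 - p) ^ 2 * t ^ 2 = -(Real.log (X ^ 10)) := by
      rw [htsq, Real.log_pow, hc₀]; push_cast; field_simp
    rw [h1, Real.exp_neg, Real.exp_log (by positivity)]
  rw [hexp, ← hX] at hB4
  -- the two-arms input at scale `P`: `K^27 T ≤ 120 κ`
  obtain ⟨T, hT⟩ : ∃ T : ℝ, T = ∑ i' : Fin 3, (bondPercolation (zdGraph 3) p).real (edgeTwoArms i' (n - K - 2)) := ⟨_, rfl⟩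
  rw [← hT] at hB4
  have hT0 : 0 ≤ T := by rw [hT]; exact Finset.sum_nonneg fun _ _ => measureReal_nonneg
  have hTle : T ≤ 3 * (κ * (1 + Real.log P) / Real.sqrt P) := by
    rw [hT]
    calc ∑ i' : Fin 3, (bondPercolation (zdGraph 3) p).real (edgeTwoArms i' (n - K - 2))
        ≤ ∑ i' : Fin 3, (bondPercolation (zdGraph 3) p).real (edgeTwoArms i' P) :=
          Finset.sum_le_sum fun i' _ => real_edgeTwoArms_anti p i' hP1 hPle
      _ ≤ ∑ _i' : Fin 3, κ * (1 + Real.log P) / Real.sqrt P :=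
          Finset.sum_le_sum fun i' _ => hκ p hδp hδp' i' P hP1
      _ = 3 * (κ * (1 + Real.log P) / Real.sqrt P) := by
          rw [Finset.sum_const, Finset.card_univ, Fintype.card_fin, nsmul_eq_mul]; push_cast; ring
  have hlogP : Real.log P = (56 * s : ℕ) * Real.log 2 := by rw [hPr, Real.log_pow]
  have hsqrtP : Real.sqrt P = 2 ^ (28 * s) := by
    rw [hPr, show (2 : ℝ) ^ (56 * s) = (2 ^ (28 * s)) ^ 2 by rw [← pow_mul]; congr 1; ring, Real.sqrt_sq (by positivity)]
  have hs1 : (s : ℝ) + 1 ≤ 2 ^ s := succ_le_two_pow_real s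
  have hs0 : (0 : ℝ) ≤ s := Nat.cast_nonneg s
  have hlog2 := log_two_le_one
  have hlog20 : 0 ≤ Real.log 2 := Real.log_nonneg one_le_two
  have hKT : (K : ℝ) ^ 27 * T ≤ 171 * κ := by
    have h1 : (K : ℝ) ^ 27 / Real.sqrt P = ((2 : ℝ) ^ s)⁻¹ := by
      rw [hsqrtP, hKr, ← pow_mul, show 28 * s = s * 27 + s by ring, pow_add]
      field_simp
    have h2 : 1 + Real.log P ≤ 57 * ((s : ℝ) + 1) := by
      rw [hlogP]
      have h56 : ((56 * s : ℕ) : ℝ) * Real.log 2 ≤ ((56 * s : ℕ) : ℝ) * 1 :=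
        mul_le_mul_of_nonneg_left hlog2 (Nat.cast_nonneg _)
      push_cast at h56 ⊢
      linarith
    have h1pos : 0 ≤ (K : ℝ) ^ 27 / Real.sqrt P := by rw [h1]; positivity
    calc (K : ℝ) ^ 27 * T ≤ (K : ℝ) ^ 27 * (3 * (κ * (1 + Real.log P) / Real.sqrt P)) :=
          mul_le_mul_of_nonneg_left hTle (by positivity)
      _ = 3 * κ * (1 + Real.log P) * ((K : ℝ) ^ 27 / Real.sqrt P) := by ring
      _ ≤ 3 * κ * (57 * ((s : ℝ) + 1)) * ((K : ℝ) ^ 27 / Real.sqrt P) :=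
          mul_le_mul_of_nonneg_right (mul_le_mul_of_nonneg_left h2 (by positivity)) h1pos
      _ = 171 * κ * (((s : ℝ) + 1) * ((2 : ℝ) ^ s)⁻¹) := by rw [h1]; ring
      _ ≤ 171 * κ * 1 := by
          refine mul_le_mul_of_nonneg_left ?_ (by positivity)
          rw [mul_inv_le_iff₀ (by positivity), one_mul]; exact hs1
      _ = 171 * κ := mul_one _
  have hA₃' : 189 + A * (K : ℝ) ^ 27 * T ≤ A₃ := by
    rw [hA₃, mul_assoc]; exact add_le_add le_rfl (mul_le_mul_of_nonneg_left hKT hA0)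
  -- the choice of `t`: `t ≤ 24 (√2)^s / √c₀`
  have hlogX : Real.log X ≤ 56 * ((s : ℝ) + 1) := by
    have h8P : X ≤ (2 : ℝ) ^ (56 * s + 3) := by
      rw [hX, pow_add, ← hPr]; linarith
    have h563 : ((56 * s + 3 : ℕ) : ℝ) * Real.log 2 ≤ ((56 * s + 3 : ℕ) : ℝ) * 1 :=
      mul_le_mul_of_nonneg_left hlog2 (Nat.cast_nonneg _)
    calc Real.log X ≤ Real.log ((2 : ℝ) ^ (56 * s + 3)) := Real.log_le_log hX0 h8P
      _ = ((56 * s + 3 : ℕ) : ℝ) * Real.log 2 := Real.log_pow _ _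
      _ ≤ 56 * ((s : ℝ) + 1) := by push_cast at h563 ⊢; linarith
  have htle : t ≤ 24 * Real.sqrt 2 ^ s / Real.sqrt c₀ := by
    rw [ht, Real.sqrt_le_iff]
    constructor
    · positivity
    · rw [div_pow, mul_pow, Real.sq_sqrt hc₀0.le, ← pow_mul, mul_comm s 2, pow_mul, Real.sq_sqrt zero_le_two]
      refine div_le_div_of_nonneg_right ?_ hc₀0.le
      have h576 : (24 : ℝ) ^ 2 = 576 := by norm_num
      have h2s : (0 : ℝ) ≤ 2 ^ s := by positivity
      rw [h576]
      linarith
  -- assemble: multiply the claim by `n³`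
  have hsq2s : 0 ≤ Real.sqrt 2 ^ s := by positivity
  have hn3 : (0 : ℝ) < (n : ℝ) ^ 3 := by positivity
  rw [← mul_le_mul_iff_of_pos_right hn3]
  have hsqn : Real.sqrt ((n : ℝ) ^ 3) * Real.sqrt n = (n : ℝ) ^ 2 := by
    rw [← Real.sqrt_mul (by positivity), show (n : ℝ) ^ 3 * n = ((n : ℝ) ^ 2) ^ 2 by ring, Real.sqrt_sq (by positivity)]
  -- term 1
  have hterm1 : t * Real.sqrt ((n : ℝ) ^ 3) * J * (189 + A * (K : ℝ) ^ 27 * T) * (Real.sqrt n * Real.sqrt 2 ^ s) ≤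
      12 / Real.sqrt c₀ * A₃ * (n : ℝ) ^ 3 := by
    have hJ0 : (0 : ℝ) ≤ J := Nat.cast_nonneg J
    calc t * Real.sqrt ((n : ℝ) ^ 3) * J * (189 + A * (K : ℝ) ^ 27 * T) * (Real.sqrt n * Real.sqrt 2 ^ s)
        = t * (Real.sqrt ((n : ℝ) ^ 3) * Real.sqrt n) * J * (189 + A * (K : ℝ) ^ 27 * T) * Real.sqrt 2 ^ s := by ring
      _ = t * (n : ℝ) ^ 2 * J * (189 + A * (K : ℝ) ^ 27 * T) * Real.sqrt 2 ^ s := by rw [hsqn]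
      _ ≤ (24 * Real.sqrt 2 ^ s / Real.sqrt c₀) * (n : ℝ) ^ 2 * J * A₃ * Real.sqrt 2 ^ s := by
          have h189 : 0 ≤ 189 + A * (K : ℝ) ^ 27 * T := by positivity
          gcongr
      _ = 24 / Real.sqrt c₀ * A₃ * (n : ℝ) ^ 2 * ((Real.sqrt 2 ^ s * Real.sqrt 2 ^ s) * J) := by ring
      _ = 24 / Real.sqrt c₀ * A₃ * (n : ℝ) ^ 2 * ((J : ℝ) * K) := by rw [sqrt_two_pow_mul_self, ← hKr]; ring
      _ ≤ 24 / Real.sqrt c₀ * A₃ * (n : ℝ) ^ 2 * ((n : ℝ) / 2) :=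
          mul_le_mul_of_nonneg_left (by linarith) (by positivity)
      _ = 12 / Real.sqrt c₀ * A₃ * (n : ℝ) ^ 3 := by ring
  -- term 2
  have hterm2 : 144 / p * X ^ 9 * (X ^ 10)⁻¹ * (Real.sqrt n * Real.sqrt 2 ^ s) ≤ 144 / p * (n : ℝ) ^ 3 := by
    have h1 : 144 / p * X ^ 9 * (X ^ 10)⁻¹ = 144 / p * X⁻¹ := by field_simp
    rw [h1]
    have hsn : Real.sqrt n ≤ n := by
      rw [Real.sqrt_le_iff]
      exact ⟨hn0.le, by rw [sq]; exact le_mul_of_one_le_right hn0.le hnr1⟩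
    have hs2 : Real.sqrt 2 ^ s ≤ (n : ℝ) := by
      calc Real.sqrt 2 ^ s ≤ 2 ^ s := pow_le_pow_left₀ (Real.sqrt_nonneg 2)
            (by rw [Real.sqrt_le_iff]; norm_num) s
        _ = K := hKr.symm
        _ ≤ n := hKlen
    have hXinv : X⁻¹ ≤ 1 := inv_le_one_of_one_le₀ hX1
    calc 144 / p * X⁻¹ * (Real.sqrt n * Real.sqrt 2 ^ s) ≤ 144 / p * 1 * ((n : ℝ) * n) := by
          gcongr
      _ ≤ 144 / p * (n : ℝ) ^ 3 := by
          rw [mul_one]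
          refine mul_le_mul_of_nonneg_left ?_ (by positivity)
          calc (n : ℝ) * n = n * n * 1 := by ring
            _ ≤ n * n * n := mul_le_mul_of_nonneg_left hnr1 (by positivity)
            _ = (n : ℝ) ^ 3 := by ring
  calc (bondPercolation (zdGraph 3) p).real (edgeTwoArms i (3 * n)) * Real.sqrt n * Real.sqrt 2 ^ s * (n : ℝ) ^ 3
      = ((n : ℝ) ^ 3 * (bondPercolation (zdGraph 3) p).real (edgeTwoArms i (3 * n))) * (Real.sqrt n * Real.sqrt 2 ^ s) := by ring
    _ ≤ (t * Real.sqrt ((n : ℝ) ^ 3) * J * (189 + A * (K : ℝ) ^ 27 * T) + 144 / p * X ^ 9 * (X ^ 10)⁻¹) *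
          (Real.sqrt n * Real.sqrt 2 ^ s) := mul_le_mul_of_nonneg_right hB4 (by positivity)
    _ = t * Real.sqrt ((n : ℝ) ^ 3) * J * (189 + A * (K : ℝ) ^ 27 * T) * (Real.sqrt n * Real.sqrt 2 ^ s) +
          144 / p * X ^ 9 * (X ^ 10)⁻¹ * (Real.sqrt n * Real.sqrt 2 ^ s) := by ring
    _ ≤ 12 / Real.sqrt c₀ * A₃ * (n : ℝ) ^ 3 + 144 / p * (n : ℝ) ^ 3 := add_le_add hterm1 hterm2
    _ = (12 / Real.sqrt c₀ * A₃ + 144 / p) * (n : ℝ) ^ 3 := by ring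

end Cerf2015BoxLRO16

end Summit.CriticalPhenomena.PercolationContinuityZ3.Theorems

end
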